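import Summits.Ventures.WeilGRH.TwistedGramFarRowsK
import Summits.Ventures.WeilGRH.TwistedGramKroneckerDot
import HarnessLib

/-!
# GRH arm: twisted format C for COMPLEX characters — cell checker `K` (part 2): Kronecker Schur sums + the front door

Cell `rh-explicit`, WEIL TRACK — GRH ARM (engine seat weil-grh-2 gen15).  Same door, same data, same entry boxes as
`TwistedGramCellCheckC` / `…CDoor` (`entryC`, `uC`, enumeration `κ`), but the Schur column sums `Σ_c M(i,c)M(i',c)/w_c` of the cell
matrix `S = M − Schur − U` cost ONE big-integer product per pair: the far rows (part 1, `TwistedGramFarRowsK`) are reduced to doubled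
midpoints with one width bound per row, packed as Kronecker digits (`TwistedGramKroneckerDot`), and `schurK` = `schurBoxK` at
`P = kronDot …` (`= Σ (lo+hi)(lo'+hi')` by `Kron.kronDot_eq`).  Measured on the farm (gen15 bench): the `(8,32)` cell's kernel time
`17.6 s → ≈ 6 s`; the `(22,88)` cells (q = 13, 15, 16, 17 at `t = 1`), infeasible with `checkCellCRows`, fit one call.
Soundness: `mem_schurK`, `mem_cellK`, then exactly as in `…CDoor`: ★ `psd_of_checkCellK` and the kernel-facing
★★ `weilPositivityOnChar_of_checkCellK` (the door `weilPositivityOnChar_of_twistedC_formatC_dataJ` at `J = 1`, `λ = 1`; its literal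
`hS` is produced inside the proof).  Everything proved; computable `def`s; RH/GRH-free.  References: H. Yoshida (1992) §§5–7
[Yoshida1992HermitianForms]; R. E. Moore (1966) Ch. 3 [Moore1966]; von zur Gathen–Gerhard (2013) §8.4 [vzGG2013];
N. J. Higham (2002) [Higham2002ASNA].
-/

set_option autoImplicit false
set_option linter.style.longLine false

open Real Complex Finset
open scoped BigOperators ArithmeticFunction.vonMangoldt ComplexConjugate

namespace Summit.Ventures.WeilGRH

open Literature.NumberTheory.LFunctions Literature.NumberTheory.LFunctions.Yoshida1992
open Literature.NumberTheory.LFunctions.Yoshida1992.Encl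
open Literature.Analysis.SpecialFunctions Literature.Analysis.ValidatedNumerics.NumericsMP
open Literature.Analysis.ValidatedNumerics (Numerics.cdiv Numerics.fdiv_mul_le_real Numerics.le_cdiv_mul_real)

open Kron

namespace TwistedEncl

/-! ## Records, the Schur box, the checker -/

/-- The digit offset `O = 2^264` (`|lo + hi| < O` is checked). [folklore] -/
def KO : ℕ := 2 ^ 264

/-- Per-row record: Kronecker packs of the doubled midpoints, `Σ|lo+hi|`, `max width`, validity flag. [folklore] -/
structure KFar where
  /-- packs / digit sum / length of the doubled midpoints -/
  kr : KRow
  /-- `Σ |lo + hi|` -/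
  sAbs : ℕ
  /-- `max (hi − lo)` -/
  wMax : ℕ
  /-- proper boxes and `|lo + hi| < O` throughout -/
  ok : Bool
  deriving Inhabited

/-- Build the record of a row of boxes (Kronecker base `Bk`). [folklore] -/
def farStats (Bk : ℕ) (row : List MI) : KFar :=
  ⟨mkKRow Bk KO (rowM row), rowSAbs row, rowWMax row, rowProper row && smallAll KO (rowM row)⟩

/-- ★ The Schur box of a pair from the two row records: `schurBoxK` at the Kronecker dot product.
[cite: vzGG2013, §8.4 (Kronecker substitution)] -/
def schurK (S Bk n : ℕ) (X Y : KFar) : MI := schurBoxK S n (kronDot Bk KO X.kr Y.kr) X.sAbs X.wMax Y.sAbs Y.wMax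

/-- The boxed cell entry `S(i,i') = M − Schur − U` from the row records. [cite: Yoshida1992HermitianForms, §7 pp. 305–312] -/
def cellK (S : ℕ) (C : Consts) (xs ys : List MI) (LQ : MI) (tab : List IdxRec) (d : CCellData) (e : CTailData) (Bk : ℕ)
    (TX TY : List KFar) (i i' : ℕ) : MI :=
  ((entryC S C xs ys LQ tab i i').sub (schurK S Bk (2 * (d.B3 - d.B)) (TX.getD i default) (TY.getD i' default))).sub
    (uC S C xs ys tab d e i i')

/-- The far records of a cell: raw rows (`x`-role) and weighted rows (`y`-role), Kronecker base `n(2O)²`. [folklore] -/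
def farRecs (S : ℕ) (C : Consts) (xs ys : List MI) (LQ : MI) (tab : List IdxRec) (d : CCellData) : List KFar × List KFar :=
  let T := farTabK S C xs ys LQ tab d 0 (2 * d.B - 1)
  let Bk := 2 * (d.B3 - d.B) * (2 * KO) ^ 2
  (T.map (farStats Bk), T.map fun row ↦ farStats Bk (scaleRowK d.wbits d.wN row 0))

/-- ★ THE CHECKER on a block (rows `i₀ ≤ i < i₀+nr`, columns `j₀ ≤ i' < j₀+nc`): the far records touched are valid and every
re-computed entry is within `ρ·2^{−c}` of the dyadic midpoint `D(i,i')`.  Only the records of the block's rows/columns are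
evaluated, so a large cell is checked in several bounded kernel calls (glue: `checkCellKBlock_glueRows/Cols`).
[cite: Moore1966, Ch. 3 (interval arithmetic: inclusion property)] -/
def checkCellKBlock (S : ℕ) (C : Consts) (xs ys : List MI) (LQ : MI) (tab : List IdxRec) (d : CCellData) (e : CTailData)
    (c : ℕ) (ρ : ℤ) (D : List (List ℤ)) (i0 nr j0 nc : ℕ) : Bool :=
  let R := farRecs S C xs ys LQ tab d
  let Bk := 2 * (d.B3 - d.B) * (2 * KO) ^ 2
  decide (0 < d.B3 - d.B) &&
    (((List.range' i0 nr).all fun i ↦ (R.1.getD i default).ok) && ((List.range' j0 nc).all fun i' ↦ (R.2.getD i' default).ok)) &&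
    (List.range' i0 nr).all fun i ↦ (List.range' j0 nc).all fun i' ↦
      enclCheck S c ρ (PsdDyadic.getMZ D i i') (cellK S C xs ys LQ tab d e Bk R.1 R.2 i i')

/-! ## Soundness -/

variable {S : ℕ} {a : ℝ} {q : ℕ}

/-- `Kron.dotZ = dotZK`. [folklore] -/
theorem dotZ_eq_dotZK : ∀ as bs : List ℤ, Kron.dotZ as bs = dotZK as bs
  | [], _ => by simp [Kron.dotZ, dotZK]
  | _ :: _, [] => by simp [Kron.dotZ, dotZK]
  | a :: as, b :: bs => by simp [Kron.dotZ, dotZK, dotZ_eq_dotZK as bs]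

/-- ★ **The Kronecker Schur box is sound**: proper boxes `X_c ∋ f c`, `Y_c ∋ g c` (`c < n`, `n ≥ 1`) with valid records
(`|lo+hi| < O`) ⇒ `Σ_{c<n} f c · g c ∈ schurK S Bk n (farStats Bk X) (farStats Bk Y)` for any base `Bk ≥ n(2O)²`.
[cite: vzGG2013, §8.4 (Kronecker substitution)] -/
theorem mem_schurK (hS : 0 < S) {X Y : List MI} {f g : ℕ → ℝ} {n Bk : ℕ} (hXl : X.length = n) (hYl : Y.length = n)
    (hn : 0 < n) (hBk : n * (2 * KO) ^ 2 ≤ Bk) (hXok : (farStats Bk X).ok = true) (hYok : (farStats Bk Y).ok = true)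
    (hf : ∀ c < n, MI.mem S (f c) (X.getD c default)) (hg : ∀ c < n, MI.mem S (g c) (Y.getD c default)) :
    MI.mem S (∑ c ∈ Finset.range n, f c * g c) (schurK S Bk n (farStats Bk X) (farStats Bk Y)) := by
  simp only [farStats, Bool.and_eq_true] at hXok hYok
  have hlen : (rowM X).length = (rowM Y).length := by rw [length_rowM, length_rowM, hXl, hYl]
  have hP : kronDot Bk KO (mkKRow Bk KO (rowM X)) (mkKRow Bk KO (rowM Y)) = dotZK (rowM X) (rowM Y) := by
    rw [← dotZ_eq_dotZK]
    exact kronDot_eq hlen (by rw [length_rowM, hXl]; exact hn) (smallAll_spec hXok.2) (smallAll_spec hYok.2)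
      (by rw [length_rowM, hXl]; exact hBk)
  exact mem_schurBoxK hS hXl hYl hXok.1 hYok.1 hf hg hP

/-- The real cell entry `S(i,i') = Re G^χ(κ_i,κ_{i'}) − Σ_c Re G(κ_i,κ_c)·(Re G(κ_{i'},κ_c)·2^{wbits}/wN[c/2]) − U(i,i')`
(`κ_c` the far column `2B−1+c`). [cite: Yoshida1992HermitianForms, §7 pp. 305–312] -/
noncomputable def cellKReal (χ : DirichletCharacter ℂ q) (a : ℝ) (d : CCellData) (e : CTailData) (i i' : ℕ) : ℝ :=
  (twistedGramCoeffC χ a (modeOfIdx i) (modeOfIdx i')).re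
    - (∑ c ∈ Finset.range (2 * (d.B3 - d.B)),
        (twistedGramCoeffC χ a (modeOfIdx i) (modeOfIdx (2 * d.B - 1 + c))).re *
          ((twistedGramCoeffC χ a (modeOfIdx i') (modeOfIdx (2 * d.B - 1 + c))).re * 2 ^ d.wbits / (d.wN.getD (c / 2) 0 : ℝ)))
    - uCReal (∑ k ∈ weilPrimeIndex a, (ArithmeticFunction.vonMangoldt k : ℝ) / Real.sqrt k) (a * (1 + weilArchDensity (2 * a)))
        ((e.θN : ℝ) / e.θD) ((e.ηN : ℝ) / e.ηD) ((d.d0N : ℝ) / 2 ^ d.wbits) d.B d.B3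
        (fun i ↦ ((Complex.digamma (1 / 4 + ((freq a (modeOfIdx i) : ℝ) : ℂ) / 2 * Complex.I)).im / 2
          + (∑ k ∈ weilPrimeIndex a, (ArithmeticFunction.vonMangoldt k : ℝ) / Real.sqrt k *
              ((χ (k : ZMod q)).re * Real.sin (freq a (modeOfIdx i) * Real.log k) +
                (χ (k : ZMod q)).im * Real.cos (freq a (modeOfIdx i) * Real.log k)))
          - archExpSumSin a (modeOfIdx i)) / Real.pi) i i'

/-- Unpack `checkCellCHead` (grouped form). [cite: Moore1966, Ch. 3 (interval arithmetic: inclusion property)] -/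
theorem checkCellCHead_specK {d : CCellData} {e : CTailData} (h : checkCellCHead d e = true) :
    (2 ≤ d.B ∧ 2 * d.B ≤ d.B3) ∧ (0 < e.θN ∧ 0 < e.θD ∧ 0 < e.ηN ∧ 0 < e.ηD) ∧ 0 < d.d0N ∧
      (∀ c < d.B3 - d.B, 0 < d.wN.getD c 0) := by
  unfold checkCellCHead at h
  simp only [Bool.and_eq_true, decide_eq_true_eq, List.all_eq_true, List.mem_range] at h
  obtain ⟨⟨⟨⟨⟨⟨⟨h1, h2⟩, h3⟩, h4⟩, h5⟩, h6⟩, h7⟩, h8⟩ := h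
  exact ⟨⟨h1, h2⟩, ⟨h3, h4, h5, h6⟩, h7, h8⟩

/-- Element `i` of the raw far records. [folklore] -/
theorem farRecs_fst_getD (S : ℕ) (C : Consts) (xs ys : List MI) (LQ : MI) (tab : List IdxRec) (d : CCellData) {i : ℕ}
    (hi : i < 2 * d.B - 1) :
    (farRecs S C xs ys LQ tab d).1.getD i default =
      farStats (2 * (d.B3 - d.B) * (2 * KO) ^ 2) (farRowK S C xs ys LQ tab d.B i 0 (2 * (d.B3 - d.B))) := by
  have hTl : (farTabK S C xs ys LQ tab d 0 (2 * d.B - 1)).length = 2 * d.B - 1 := length_farTabK S C xs ys LQ tab d 0 _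
  have hl : i < (farRecs S C xs ys LQ tab d).1.length := by show i < (List.map _ _).length; simp [hTl, hi]
  rw [List.getD_eq_getElem _ _ hl]
  show (List.map _ _)[i] = _
  rw [List.getElem_map]
  congr 1
  rw [← List.getD_eq_getElem _ [] (by simp [hTl, hi]), getD_farTabK S C xs ys LQ tab d 0 _ i hi, zero_add]

/-- Element `i'` of the weighted far records. [folklore] -/
theorem farRecs_snd_getD (S : ℕ) (C : Consts) (xs ys : List MI) (LQ : MI) (tab : List IdxRec) (d : CCellData) {i : ℕ}
    (hi : i < 2 * d.B - 1) :
    (farRecs S C xs ys LQ tab d).2.getD i default =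
      farStats (2 * (d.B3 - d.B) * (2 * KO) ^ 2)
        (scaleRowK d.wbits d.wN (farRowK S C xs ys LQ tab d.B i 0 (2 * (d.B3 - d.B))) 0) := by
  have hTl : (farTabK S C xs ys LQ tab d 0 (2 * d.B - 1)).length = 2 * d.B - 1 := length_farTabK S C xs ys LQ tab d 0 _
  have hl : i < (farRecs S C xs ys LQ tab d).2.length := by show i < (List.map _ _).length; simp [hTl, hi]
  rw [List.getD_eq_getElem _ _ hl]
  show (List.map _ _)[i] = _
  rw [List.getElem_map]
  congr 2
  rw [← List.getD_eq_getElem _ [] (by simp [hTl, hi]), getD_farTabK S C xs ys LQ tab d 0 _ i hi, zero_add]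

/-- ★ `cellK ∋ S(i,i')` for valid data, `i, i' < 2B−1`, `B₃ ≤ N`, valid far records. [cite: Moore1966, Ch. 3 (interval arithmetic: inclusion property)] -/
theorem mem_cellK (hS : 0 < S) (ha0 : 0 < a) {ks : List PrimeLen} (hks : PrimeData a ks) {C : Consts}
    (hC : ConstsValid S a ks C) (χ : DirichletCharacter ℂ q) {xs ys : List MI}
    (hx : ∀ i < ks.length, MI.mem S (χ (((ks.getD i default).val : ℕ) : ZMod q)).re (xs.getD i default))
    (hy : ∀ i < ks.length, MI.mem S (χ (((ks.getD i default).val : ℕ) : ZMod q)).im (ys.getD i default))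
    {LQ : MI} (hLQ : MI.mem S (Real.log q) LQ) {N : ℕ} {tab : List IdxRec} (hT : TabValid S a ks N tab)
    {d : CCellData} {e : CTailData} (hN : d.B3 ≤ N) (hh : checkCellCHead d e = true) (hfar : 0 < d.B3 - d.B)
    (hCC : MI.mem S (a * (1 + weilArchDensity (2 * a))) d.CC)
    {i i' : ℕ} (hi : i < 2 * d.B - 1) (hi' : i' < 2 * d.B - 1)
    (hok1 : ((farRecs S C xs ys LQ tab d).1.getD i default).ok = true) (hok2 : ((farRecs S C xs ys LQ tab d).2.getD i' default).ok = true) :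
    MI.mem S (cellKReal χ a d e i i')
      (cellK S C xs ys LQ tab d e (2 * (d.B3 - d.B) * (2 * KO) ^ 2) (farRecs S C xs ys LQ tab d).1 (farRecs S C xs ys LQ tab d).2 i i') := by
  obtain ⟨⟨hB2, hBB3⟩, ⟨hθN, hθD, hηN, hηD⟩, hd0, hw⟩ := checkCellCHead_specK hh
  have hiN : i < 2 * N - 1 := by omega
  have hi'N : i' < 2 * N - 1 := by omega
  have hTX := farRecs_fst_getD S C xs ys LQ tab d hi
  have hTY := farRecs_snd_getD S C xs ys LQ tab d hi'
  have hXok := hok1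
  have hYok := hok2
  rw [hTX] at hXok
  rw [hTY] at hYok
  unfold cellK cellKReal
  rw [hTX, hTY]
  refine MI.mem_sub (MI.mem_sub (mem_entryC hS ha0 hks hC χ hx hy hLQ hT hiN hi'N) ?_)
    (mem_uC hS hks hC χ hx hy hT hθN hθD hηN hηD hd0 (by omega) (by omega) hCC hiN hi'N)
  refine mem_schurK hS (length_farRowK S C xs ys LQ tab d.B i 0 _)
    (by rw [length_scaleRowK, length_farRowK]) (by omega) le_rfl hXok hYok ?_ ?_
  · intro c hc
    rw [getD_farRowK S C xs ys LQ tab d.B i 0 _ c hc, zero_add]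
    exact mem_entryC hS ha0 hks hC χ hx hy hLQ hT hiN (by omega)
  · intro c hc
    rw [getD_scaleRowK d.wbits d.wN _ 0 c (by rw [length_farRowK]; exact hc), getD_farRowK S C xs ys LQ tab d.B i' 0 _ c hc]
    simp only [zero_add]
    have hwc : 0 < d.wN.getD (c / 2) 0 := hw (c / 2) (by omega)
    have h := MI.mem_divNat (MI.mem_mulInt (mem_entryC hS ha0 hks hC χ hx hy hLQ hT hi'N (by omega : 2 * d.B - 1 + c < 2 * N - 1))
      ((2 : ℤ) ^ d.wbits)) hwc
    refine mem_of_eq h ?_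
    push_cast; ring

/-- Semantics of the block checker. [cite: Moore1966, Ch. 3 (interval arithmetic: inclusion property)] -/
theorem checkCellKBlock_iff {C : Consts} {xs ys : List MI} {LQ : MI} {tab : List IdxRec} {d : CCellData} {e : CTailData}
    {c : ℕ} {ρ : ℤ} {D : List (List ℤ)} {i0 nr j0 nc : ℕ} :
    checkCellKBlock S C xs ys LQ tab d e c ρ D i0 nr j0 nc = true ↔
      0 < d.B3 - d.B ∧
      ((∀ i, i0 ≤ i → i < i0 + nr → ((farRecs S C xs ys LQ tab d).1.getD i default).ok = true) ∧
        (∀ i', j0 ≤ i' → i' < j0 + nc → ((farRecs S C xs ys LQ tab d).2.getD i' default).ok = true)) ∧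
      ∀ i, i0 ≤ i → i < i0 + nr → ∀ i', j0 ≤ i' → i' < j0 + nc → enclCheck S c ρ (PsdDyadic.getMZ D i i')
        (cellK S C xs ys LQ tab d e (2 * (d.B3 - d.B) * (2 * KO) ^ 2)
          (farRecs S C xs ys LQ tab d).1 (farRecs S C xs ys LQ tab d).2 i i') = true := by
  unfold checkCellKBlock
  simp only [Bool.and_eq_true, decide_eq_true_eq, List.all_eq_true, List.mem_range'_1, and_imp, and_assoc]

/-- Two row ranges of blocks with the same columns glue. [folklore] -/
theorem checkCellKBlock_glueRows {C : Consts} {xs ys : List MI} {LQ : MI} {tab : List IdxRec} {d : CCellData} {e : CTailData}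
    {c : ℕ} {ρ : ℤ} {D : List (List ℤ)} {i0 n1 i1 n2 n j0 nc : ℕ}
    (h1 : checkCellKBlock S C xs ys LQ tab d e c ρ D i0 n1 j0 nc = true)
    (h2 : checkCellKBlock S C xs ys LQ tab d e c ρ D i1 n2 j0 nc = true)
    (hi : i1 = i0 + n1) (hn : n = n1 + n2) : checkCellKBlock S C xs ys LQ tab d e c ρ D i0 n j0 nc = true := by
  subst hi hn
  rw [checkCellKBlock_iff] at h1 h2 ⊢
  refine ⟨h1.1, ⟨fun i hi1 hi2 ↦ ?_, h1.2.1.2⟩, fun i hi1 hi2 i' hj1 hj2 ↦ ?_⟩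
  · by_cases h : i < i0 + n1
    · exact h1.2.1.1 i hi1 h
    · exact h2.2.1.1 i (by omega) (by omega)
  · by_cases h : i < i0 + n1
    · exact h1.2.2 i hi1 h i' hj1 hj2
    · exact h2.2.2 i (by omega) (by omega) i' hj1 hj2

/-- Two column ranges of blocks with the same rows glue. [folklore] -/
theorem checkCellKBlock_glueCols {C : Consts} {xs ys : List MI} {LQ : MI} {tab : List IdxRec} {d : CCellData} {e : CTailData}
    {c : ℕ} {ρ : ℤ} {D : List (List ℤ)} {i0 nr j0 c1 j1 c2 nc : ℕ}
    (h1 : checkCellKBlock S C xs ys LQ tab d e c ρ D i0 nr j0 c1 = true)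
    (h2 : checkCellKBlock S C xs ys LQ tab d e c ρ D i0 nr j1 c2 = true)
    (hj : j1 = j0 + c1) (hn : nc = c1 + c2) : checkCellKBlock S C xs ys LQ tab d e c ρ D i0 nr j0 nc = true := by
  subst hj hn
  rw [checkCellKBlock_iff] at h1 h2 ⊢
  refine ⟨h1.1, ⟨h1.2.1.1, fun i' hj1 hj2 ↦ ?_⟩, fun i hi1 hi2 i' hj1 hj2 ↦ ?_⟩
  · by_cases h : i' < j0 + c1
    · exact h1.2.1.2 i' hj1 h
    · exact h2.2.1.2 i' (by omega) (by omega)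
  · by_cases h : i' < j0 + c1
    · exact h1.2.2 i hi1 hi2 i' hj1 h
    · exact h2.2.2 i hi1 hi2 i' (by omega) (by omega)

/-- ★ **The PSD fact of the cell (clean form)** from the header, the full row range and the dyadic PSD certificate.
[cite: Yoshida1992HermitianForms, §7 pp. 305–312] -/
theorem psd_of_checkCellK (hS : 0 < S) (ha0 : 0 < a) {ks : List PrimeLen} (hks : PrimeData a ks) {C : Consts}
    (hC : ConstsValid S a ks C) (χ : DirichletCharacter ℂ q) {xs ys : List MI}
    (hx : ∀ i < ks.length, MI.mem S (χ (((ks.getD i default).val : ℕ) : ZMod q)).re (xs.getD i default))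
    (hy : ∀ i < ks.length, MI.mem S (χ (((ks.getD i default).val : ℕ) : ZMod q)).im (ys.getD i default))
    {LQ : MI} (hLQ : MI.mem S (Real.log q) LQ) {N : ℕ} {tab : List IdxRec} (hT : TabValid S a ks N tab)
    {d : CCellData} {e : CTailData} (hN : d.B3 ≤ N) (hCC : MI.mem S (a * (1 + weilArchDensity (2 * a))) d.CC)
    {c : ℕ} {ρ δ : ℤ} {D L : List (List ℤ)} (hh : checkCellCHead d e = true)
    (hrows : checkCellKBlock S C xs ys LQ tab d e c ρ D 0 (2 * d.B - 1) 0 (2 * d.B - 1) = true)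
    (hpsd : PsdDyadic.checkPsdMid (2 * d.B - 1) δ ρ D L = true) :
    ∀ x : Fin (2 * d.B - 1) → ℝ, 0 ≤ ∑ i, ∑ i', x i * x i' * cellKReal χ a d e i i' := by
  obtain ⟨hfar, ⟨hok1, hok2⟩, hr⟩ := checkCellKBlock_iff.mp hrows
  have hnear : ∀ i i' : Fin (2 * d.B - 1), |cellKReal χ a d e i i' - (PsdDyadic.getMZ D i i' : ℝ) * (1 / 2 ^ c)| ≤ (ρ : ℝ) * (1 / 2 ^ c) :=
    fun i i' ↦ abs_sub_le_of_enclCheck hS (hr i (Nat.zero_le _) (by simp [i.isLt]) i' (Nat.zero_le _) (by simp [i'.isLt]))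
      (mem_cellK hS ha0 hks hC χ hx hy hLQ hT hN hh hfar hCC i.isLt i'.isLt
        (hok1 i (Nat.zero_le _) (by simp [i.isLt])) (hok2 i' (Nat.zero_le _) (by simp [i'.isLt])))
  exact PsdDyadic.psd_of_checkPsdMid hpsd (u := 1 / 2 ^ c) (by positivity) (fun i i' ↦ cellKReal χ a d e i i') hnear

/-- ★★ **Front door of the complex χ-cell lane, checker `K`.**  Valid constants / prime data at `a`; boxes `xs ∋ Re χ(k)`,
`ys ∋ Im χ(k)` on the listed prime powers; `LQ ∋ log q`; the table valid below `N > B₃`; `CC`, `AOP`; and the four kernel checks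
`checkSignsC`, `checkCellCHead`, `checkCellKBlock` (full block), `PsdDyadic.checkPsdMid` ⇒ `WeilPositivityOnChar χ a`, by the data door
`weilPositivityOnChar_of_twistedC_formatC_dataJ` at `J = 1`, `λ = 1`, `M(i,i') = Re G^χ(κ_i, κ_{i'})`.
[cite: Yoshida1992HermitianForms, §7 pp. 305–312] -/
theorem weilPositivityOnChar_of_checkCellK (hq : q ≠ 1) (hS : 0 < S) (ha0 : 0 < a) {Karc : ℕ} {ks : List PrimeLen}
    (hks : PrimeData a ks) {C : Consts} (hC : ConstsValid S a ks C) (χ : DirichletCharacter ℂ q) {xs ys : List MI}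
    (hx : ∀ i < ks.length, MI.mem S (χ (((ks.getD i default).val : ℕ) : ZMod q)).re (xs.getD i default))
    (hy : ∀ i < ks.length, MI.mem S (χ (((ks.getD i default).val : ℕ) : ZMod q)).im (ys.getD i default))
    {LQ : MI} (hLQ : MI.mem S (Real.log q) LQ) {N : ℕ} {tab : List IdxRec} (hT : TabValid S a ks N tab)
    {d : CCellData} {e : CTailData} (hN : d.B3 < N) (hCC : MI.mem S (a * (1 + weilArchDensity (2 * a))) d.CC)
    (hAOP : MI.mem S (∑ k ∈ weilPrimeIndex a, (Λ k : ℝ) / Real.sqrt k * (2 * Real.cos (π / (⌊2 * a / Real.log k⌋₊ + 2)))) d.AOP)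
    (hsg : checkSignsC S Karc C LQ tab d = true)
    {c : ℕ} {ρ δ : ℤ} {D L : List (List ℤ)} (hh : checkCellCHead d e = true)
    (hrows : checkCellKBlock S C xs ys LQ tab d e c ρ D 0 (2 * d.B - 1) 0 (2 * d.B - 1) = true)
    (hpsd : PsdDyadic.checkPsdMid (2 * d.B - 1) δ ρ D L = true) :
    WeilPositivityOnChar χ a := by
  obtain ⟨⟨hB2, hBB3⟩, ⟨hθN, hθD, hηN, hηD⟩, -, -⟩ := checkCellCHead_specK hh
  obtain ⟨h0, hd0, hw⟩ := signsC_of_checkSignsC hS ha0 hC hLQ hT hN hCC hAOP hsg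
  have key := psd_of_checkCellK hS ha0 hks hC χ hx hy hLQ hT hN.le hCC hh hrows hpsd
  -- the enumeration: `κ(ι(p)) = p` and `(−1)^{κ_i} = sgnOfIdx i`
  have hiota : ∀ p : ℤ, modeOfIdx (if 0 < p then 2 * p.natAbs - 1 else 2 * p.natAbs) = p := by
    intro p
    unfold modeOfIdx
    obtain ⟨n, rfl | rfl⟩ := Int.eq_nat_or_neg p
    · by_cases hn : n = 0
      · subst hn; simp
      · have hp : (0 : ℤ) < (n : ℤ) := by omega
        rw [if_pos hp, Int.natAbs_natCast]
        have h1 : (2 * n - 1) % 2 = 1 := by omega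
        rw [if_pos h1]
        have h2 : (2 * n - 1 + 1) / 2 = n := by omega
        rw [h2]
    · have hp : ¬ (0 : ℤ) < -(n : ℤ) := by omega
      rw [if_neg hp, Int.natAbs_neg, Int.natAbs_natCast]
      have h1 : ¬ (2 * n) % 2 = 1 := by omega
      rw [if_neg h1]
      have h2 : 2 * n / 2 = n := by omega
      rw [h2]
  have hsgn : ∀ i : ℕ, (-1 : ℝ) ^ (if i % 2 = 1 then (((i + 1) / 2 : ℕ) : ℤ) else -(((i / 2 : ℕ)) : ℤ)) = ((sgnOfIdx i : ℤ) : ℝ) := by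
    intro i
    have e1 : (if i % 2 = 1 then (((i + 1) / 2 : ℕ) : ℤ) else -(((i / 2 : ℕ)) : ℤ)) = modeOfIdx i := rfl
    rw [e1]
    unfold sgnOfIdx
    by_cases h : (modeOfIdx i).natAbs % 2 = 0
    · rw [if_pos h, (Int.natAbs_even.mp (Nat.even_iff.mpr h)).neg_one_zpow]; push_cast; rfl
    · rw [if_neg h, (Int.natAbs_odd.mp (Nat.odd_iff.mpr (by omega))).neg_one_zpow]; push_cast; rfl
  refine weilPositivityOnChar_of_twistedC_formatC_dataJ hq χ ha0
    (fun i i' ↦ (twistedGramCoeffC χ a (modeOfIdx i) (modeOfIdx i')).re)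
    (fun j j' ↦ congrArg Complex.re (twistedGramCoeffC_comm χ a _ _))
    (fun p p' ↦ by simp only [hiota]) hB2 hBB3 1 (fun _ ↦ 1) (fun _ ↦ one_pos)
    (θ := (e.θN : ℝ) / e.θD) (η := (e.ηN : ℝ) / e.ηD) (d₀ := (d.d0N : ℝ) / 2 ^ d.wbits)
    (div_pos (Nat.cast_pos.mpr hθN) (Nat.cast_pos.mpr hθD)) (div_pos (Nat.cast_pos.mpr hηN) (Nat.cast_pos.mpr hηD))
    (fun j ↦ (d.wN.getD ((j + 1) / 2 - d.B) 0 : ℝ) / 2 ^ d.wbits) h0 hd0 hw ?_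
  intro x
  refine (key x).trans_eq (Finset.sum_congr rfl fun i _ ↦ Finset.sum_congr rfl fun i' _ ↦ ?_)
  congr 1
  have hIco : ∀ (f : ℕ → ℝ), ∑ j ∈ Finset.Ico (2 * d.B - 1) (2 * d.B3 - 1), f j =
      ∑ c' ∈ Finset.range (2 * (d.B3 - d.B)), f (2 * d.B - 1 + c') := by
    intro f
    rw [Finset.sum_Ico_eq_sum_range, show 2 * d.B3 - 1 - (2 * d.B - 1) = 2 * (d.B3 - d.B) by omega]
  have hwIdx : ∀ c' : ℕ, (2 * d.B - 1 + c' + 1) / 2 - d.B = c' / 2 := fun c' ↦ by omega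
  rw [hIco]
  simp only [hwIdx, Matrix.of_apply]
  unfold cellKReal uCReal
  have hsch : ∀ (u v w : ℕ → ℝ), (∑ c ∈ Finset.range (2 * (d.B3 - d.B)), u c * (v c * 2 ^ d.wbits / w c)) =
      ∑ c ∈ Finset.range (2 * (d.B3 - d.B)), u c * v c / (w c / 2 ^ d.wbits) := fun u v w ↦
    Finset.sum_congr rfl fun c _ ↦ by rw [div_div_eq_mul_div]; ring
  rw [hsch]
  by_cases hii : i = i'
  · simp only [modeOfIdx, hsgn, Fin.sum_univ_one, Fin.val_zero, Fin.isValue, pow_zero, pow_one,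
      mul_one, div_one, if_pos hii, if_pos (congrArg Fin.val hii), Nat.cast_natAbs]
    push_cast
    ring
  · have hii' : (i : ℕ) ≠ (i' : ℕ) := fun h ↦ hii (Fin.ext h)
    simp only [modeOfIdx, hsgn, Fin.sum_univ_one, Fin.val_zero, Fin.isValue, pow_zero, pow_one,
      mul_one, div_one, hii, hii', if_false]
    push_cast
    ring

end TwistedEncl

end Summit.Ventures.WeilGRH
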